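import Summits.Ventures.PercRepro.C026GoodDegreeBridge

/-!
# STAGE 1 of the `(E00)` accounting and the exact residual (p6, gen 20)

Setting of `C026PFunE00Count` / `C026GoodDegreeBridge`: skeleton `(G; a, b, c)`, red = the
configuration `S`, blue = `Sᶜ`; `(D,A)` = `c, a, b` pairwise red-joined and pairwise blue-separated;
`(D,¬A)` = red type `D`, blue type not `A`; `|B|` = red type `B` (`c` joined to exactly one of `a, b`);
`n(B,C)` = red type `B`, blue type `C`; `Good_t` = some red walk from `c` to the other live vertex
avoids the blue cluster of `t`; `Bad` = neither `Good_a` nor `Good_b`.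

**STAGE 1** (mine-3 §37 (a)): the open-cluster flip `Ψ_c = kSwap c` (typer-1's K-swap: flip every
edge at the RED cluster `K` of `c`) has blue cluster of `c` equal to `K` (`cluster_compl_kSwap`), so for
`S ∈ (D,A)` the blue type of `Ψ_c(S)` is `D`; the **doubly extreme** sources are

  `X₂ := {S ∈ (D,A) : Ψ_c(S) has red type A}`  (`c, a, b` pairwise red-separated in `kSwap c S`).

For `S ∈ (D,A) ∖ X₂` the complement `(Ψ_c S)ᶜ` has red type `D` and blue type `≠ A`, and
`S ↦ (Ψ_c S)ᶜ` is injective (`kSwap_injective`), so `n(D,A) ≤ #X₂ + n(D,¬A)`.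

* `kSwap_mem_DnotA_of_not_X2` — the image type;
* `card_DA_sdiff_X2_le` — `#((D,A) ∖ X₂) ≤ n(D,¬A)`;
* `card_DA_le_X2_add` — **STAGE 1**: `n(D,A) ≤ #X₂ + n(D,¬A)`;
* `pFun_liveCells_nonneg_of_X2` — `#X₂ ≤ 2|B| + 2 n(B,C)` ⟹ `(E00)`;
* `card_X2_le_B_add_bad` — with STAGE 2 (`C026GoodDegreeBridge`): `#X₂ ≤ |B| + #(X₂ ∩ Bad)`;
* `pFun_liveCells_nonneg_of_residual` — **THE EXACT RESIDUAL**: `#(X₂ ∩ Bad) ≤ |B| + 2 n(B,C)` ⟹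
  `(E00)`, and `pFun_threeCells_nonneg_of_residual` — ⟹ THEOREM L2 (live probe, every band state).

So what is left of the two-live-vertex case of CONJECTURE (P), in the kernel, is the count
`#(X₂ ∩ Bad) ≤ |B| + 2 n(B,C)` on the skeleton: the doubly extreme Bad sources against the red-`B`
configurations with the `(B,C)` capacity doubled (mine-3's (TWO-CHOICE) / (CC) programme lives here;
room ≥ 2.6 in the censuses).  No distinctness of `a, b, c` is assumed.
-/

namespace PercRepro

namespace MultiGraph

open Finset

variable {V E : Type*} {G : MultiGraph V E}

/-- **STAGE 1, the image type** (mine-3 §37 (a)): for `S ∈ (D,A)` whose open-cluster flip `Ψ_c(S)`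
does not have red type `A`, the complement of `Ψ_c(S)` has red type `D` and blue type `≠ A`. -/
theorem kSwap_mem_DnotA_of_not_X2 {S : Config E} {a b c : V} (hca : G.Conn S c a)
    (hcb : G.Conn S c b)
    (hX : ¬ (¬ G.Conn (G.kSwap c S) c a ∧ ¬ G.Conn (G.kSwap c S) c b ∧
      ¬ G.Conn (G.kSwap c S) a b)) :
    (G.Conn (G.kSwap c S)ᶜ c a ∧ G.Conn (G.kSwap c S)ᶜ c b) ∧
      (G.Conn (G.kSwap c S)ᶜᶜ c a ∨ G.Conn (G.kSwap c S)ᶜᶜ c b ∨ G.Conn (G.kSwap c S)ᶜᶜ a b) := by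
  refine ⟨⟨(G.conn_compl_kSwap_iff c a S).2 hca, (G.conn_compl_kSwap_iff c b S).2 hcb⟩, ?_⟩
  rw [compl_compl]
  by_contra h
  exact hX ⟨fun h1 => h (Or.inl h1), fun h2 => h (Or.inr (Or.inl h2)),
    fun h3 => h (Or.inr (Or.inr h3))⟩

/-- `S ↦ (Ψ_c S)ᶜ` is injective. -/
theorem compl_kSwap_injective (c : V) : Function.Injective (fun S : Config E => (G.kSwap c S)ᶜ) :=
  fun _ _ h => G.kSwap_injective c (compl_injective h)

section Count

variable [Fintype V] [DecidableEq V] [Fintype E] [DecidableEq E]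

omit [Fintype V] [DecidableEq V] in
open Classical in
/-- **`#((D,A) ∖ X₂) ≤ n(D,¬A)`**: the sources that are not doubly extreme inject into the
configurations of red type `D` and blue type `≠ A`, by `S ↦ (Ψ_c S)ᶜ`. -/
theorem card_DA_sdiff_X2_le (a b c : V) :
    (univ.filter fun S : Config E => ((G.Conn S c a ∧ G.Conn S c b) ∧
        (¬ G.Conn Sᶜ c a ∧ ¬ G.Conn Sᶜ c b ∧ ¬ G.Conn Sᶜ a b)) ∧
        ¬ (¬ G.Conn (G.kSwap c S) c a ∧ ¬ G.Conn (G.kSwap c S) c b ∧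
          ¬ G.Conn (G.kSwap c S) a b)).card ≤
      (univ.filter fun T : Config E => (G.Conn T c a ∧ G.Conn T c b) ∧
        (G.Conn Tᶜ c a ∨ G.Conn Tᶜ c b ∨ G.Conn Tᶜ a b)).card := by
  refine Finset.card_le_card_of_injOn (fun S => (G.kSwap c S)ᶜ) ?_ ?_
  · intro S hS
    simp only [coe_filter, mem_univ, true_and, Set.mem_setOf_eq] at hS ⊢
    exact kSwap_mem_DnotA_of_not_X2 hS.1.1.1 hS.1.1.2 hS.2
  · intro S _ S' _ h
    exact compl_kSwap_injective c h

omit [Fintype V] [DecidableEq V] in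
open Classical in
/-- **STAGE 1** (mine-3 §37 (a), kernel form): `n(D,A) ≤ #X₂ + n(D,¬A)`, with `X₂` the doubly extreme
sources (`(D,A)` configurations whose open-cluster flip `Ψ_c` has red type `A`). -/
theorem card_DA_le_X2_add (a b c : V) :
    (univ.filter fun S : Config E => (G.Conn S c a ∧ G.Conn S c b) ∧
        (¬ G.Conn Sᶜ c a ∧ ¬ G.Conn Sᶜ c b ∧ ¬ G.Conn Sᶜ a b)).card ≤
      (univ.filter fun S : Config E => ((G.Conn S c a ∧ G.Conn S c b) ∧
        (¬ G.Conn Sᶜ c a ∧ ¬ G.Conn Sᶜ c b ∧ ¬ G.Conn Sᶜ a b)) ∧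
        (¬ G.Conn (G.kSwap c S) c a ∧ ¬ G.Conn (G.kSwap c S) c b ∧
          ¬ G.Conn (G.kSwap c S) a b)).card +
      (univ.filter fun T : Config E => (G.Conn T c a ∧ G.Conn T c b) ∧
        (G.Conn Tᶜ c a ∨ G.Conn Tᶜ c b ∨ G.Conn Tᶜ a b)).card := by
  have hsplit := Finset.card_filter_add_card_filter_not
    (s := univ.filter fun S : Config E => (G.Conn S c a ∧ G.Conn S c b) ∧
      (¬ G.Conn Sᶜ c a ∧ ¬ G.Conn Sᶜ c b ∧ ¬ G.Conn Sᶜ a b))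
    (fun S : Config E => ¬ G.Conn (G.kSwap c S) c a ∧ ¬ G.Conn (G.kSwap c S) c b ∧
      ¬ G.Conn (G.kSwap c S) a b)
  rw [Finset.filter_filter, Finset.filter_filter] at hsplit
  have h := card_DA_sdiff_X2_le (G := G) a b c
  omega

open Classical in
/-- **`#X₂ ≤ 2|B| + 2 n(B,C)` ⟹ `(E00)`** (mine-3 §37 (a)): STAGE 1 pays every source outside `X₂`
with the `n(D,¬A)` capacity. -/
theorem pFun_liveCells_nonneg_of_X2 (a b c : V)
    (hX : (univ.filter fun S : Config E => ((G.Conn S c a ∧ G.Conn S c b) ∧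
          (¬ G.Conn Sᶜ c a ∧ ¬ G.Conn Sᶜ c b ∧ ¬ G.Conn Sᶜ a b)) ∧
          (¬ G.Conn (G.kSwap c S) c a ∧ ¬ G.Conn (G.kSwap c S) c b ∧
            ¬ G.Conn (G.kSwap c S) a b)).card ≤
        2 * (univ.filter fun T : Config E =>
            (G.Conn T c a ∧ ¬ G.Conn T c b) ∨ (G.Conn T c b ∧ ¬ G.Conn T c a)).card +
        2 * (univ.filter fun T : Config E =>
            ((G.Conn T c a ∧ ¬ G.Conn T c b) ∨ (G.Conn T c b ∧ ¬ G.Conn T c a)) ∧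
            (G.Conn Tᶜ a b ∧ ¬ G.Conn Tᶜ c a)).card) :
    0 ≤ G.pFun c (liveCells a b) (liveCells a b) univ := by
  rw [pFun_liveCells_nonneg_iff]
  have h := card_DA_le_X2_add (G := G) a b c
  omega

omit [Fintype V] [DecidableEq V] in
open Classical in
/-- **`#X₂ ≤ |B| + #(X₂ ∩ Bad)`**: the doubly extreme sources that are `Good_a` or `Good_b` are paid
by STAGE 2 (`card_good_add_good_le`), the rest is the residual. -/
theorem card_X2_le_B_add_bad (a b c : V) :
    (univ.filter fun S : Config E => ((G.Conn S c a ∧ G.Conn S c b) ∧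
        (¬ G.Conn Sᶜ c a ∧ ¬ G.Conn Sᶜ c b ∧ ¬ G.Conn Sᶜ a b)) ∧
        (¬ G.Conn (G.kSwap c S) c a ∧ ¬ G.Conn (G.kSwap c S) c b ∧
          ¬ G.Conn (G.kSwap c S) a b)).card ≤
      (univ.filter fun T : Config E =>
        (G.Conn T c a ∧ ¬ G.Conn T c b) ∨ (G.Conn T c b ∧ ¬ G.Conn T c a)).card +
      (univ.filter fun S : Config E => (((G.Conn S c a ∧ G.Conn S c b) ∧
        (¬ G.Conn Sᶜ c a ∧ ¬ G.Conn Sᶜ c b ∧ ¬ G.Conn Sᶜ a b)) ∧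
        (¬ G.Conn (G.kSwap c S) c a ∧ ¬ G.Conn (G.kSwap c S) c b ∧
          ¬ G.Conn (G.kSwap c S) a b)) ∧
        ¬ (G.WalkAvoiding S (G.cluster Sᶜ a) c b ∨ G.WalkAvoiding S (G.cluster Sᶜ b) c a)).card := by
  -- split `X₂` by `Good_a ∨ Good_b`
  have hsplit := Finset.card_filter_add_card_filter_not
    (s := univ.filter fun S : Config E => ((G.Conn S c a ∧ G.Conn S c b) ∧
      (¬ G.Conn Sᶜ c a ∧ ¬ G.Conn Sᶜ c b ∧ ¬ G.Conn Sᶜ a b)) ∧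
      (¬ G.Conn (G.kSwap c S) c a ∧ ¬ G.Conn (G.kSwap c S) c b ∧
        ¬ G.Conn (G.kSwap c S) a b))
    (fun S : Config E => G.WalkAvoiding S (G.cluster Sᶜ a) c b ∨
      G.WalkAvoiding S (G.cluster Sᶜ b) c a)
  rw [Finset.filter_filter, Finset.filter_filter] at hsplit
  -- the Good part of `X₂` is inside `Good_a ∪ Good_b`, which has at most `|B|` elements
  have hgood : (univ.filter fun S : Config E => (((G.Conn S c a ∧ G.Conn S c b) ∧
        (¬ G.Conn Sᶜ c a ∧ ¬ G.Conn Sᶜ c b ∧ ¬ G.Conn Sᶜ a b)) ∧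
        (¬ G.Conn (G.kSwap c S) c a ∧ ¬ G.Conn (G.kSwap c S) c b ∧
          ¬ G.Conn (G.kSwap c S) a b)) ∧
        (G.WalkAvoiding S (G.cluster Sᶜ a) c b ∨ G.WalkAvoiding S (G.cluster Sᶜ b) c a)).card ≤
      (univ.filter fun S : Config E => ((G.Conn S c a ∧ G.Conn S c b) ∧
        (¬ G.Conn Sᶜ c a ∧ ¬ G.Conn Sᶜ c b ∧ ¬ G.Conn Sᶜ a b)) ∧
        G.WalkAvoiding S (G.cluster Sᶜ a) c b).card +
      (univ.filter fun S : Config E => ((G.Conn S c a ∧ G.Conn S c b) ∧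
        (¬ G.Conn Sᶜ c a ∧ ¬ G.Conn Sᶜ c b ∧ ¬ G.Conn Sᶜ a b)) ∧
        G.WalkAvoiding S (G.cluster Sᶜ b) c a).card := by
    refine le_trans (Finset.card_le_card ?_) (Finset.card_union_le _ _)
    intro S hS
    simp only [mem_filter, mem_univ, true_and, mem_union] at hS ⊢
    rcases hS.2 with h | h
    · exact Or.inl ⟨hS.1.1, h⟩
    · exact Or.inr ⟨hS.1.1, h⟩
  have h2 := card_good_add_good_le (G := G) a b c
  omega

open Classical in
/-- **THE EXACT RESIDUAL OF THEOREM L2**: if the doubly extreme Bad sources satisfy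
`#(X₂ ∩ Bad) ≤ |B| + 2 n(B,C)`, then `(E00)` holds on the skeleton. -/
theorem pFun_liveCells_nonneg_of_residual (a b c : V)
    (hR : (univ.filter fun S : Config E => (((G.Conn S c a ∧ G.Conn S c b) ∧
          (¬ G.Conn Sᶜ c a ∧ ¬ G.Conn Sᶜ c b ∧ ¬ G.Conn Sᶜ a b)) ∧
          (¬ G.Conn (G.kSwap c S) c a ∧ ¬ G.Conn (G.kSwap c S) c b ∧
            ¬ G.Conn (G.kSwap c S) a b)) ∧
          ¬ (G.WalkAvoiding S (G.cluster Sᶜ a) c b ∨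
            G.WalkAvoiding S (G.cluster Sᶜ b) c a)).card ≤
        (univ.filter fun T : Config E =>
            (G.Conn T c a ∧ ¬ G.Conn T c b) ∨ (G.Conn T c b ∧ ¬ G.Conn T c a)).card +
        2 * (univ.filter fun T : Config E =>
            ((G.Conn T c a ∧ ¬ G.Conn T c b) ∨ (G.Conn T c b ∧ ¬ G.Conn T c a)) ∧
            (G.Conn Tᶜ a b ∧ ¬ G.Conn Tᶜ c a)).card) :
    0 ≤ G.pFun c (liveCells a b) (liveCells a b) univ := by
  apply pFun_liveCells_nonneg_of_X2
  have h := card_X2_le_B_add_bad (G := G) a b c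
  omega

open Classical in
/-- **THEOREM L2 (live probe) modulo the exact residual**: `#(X₂ ∩ Bad) ≤ |B| + 2 n(B,C)` on the
skeleton gives `(P) ≥ 0` at every band state of the probe and of the two live vertices. -/
theorem pFun_threeCells_nonneg_of_residual (a b c : V)
    (hR : (univ.filter fun S : Config E => (((G.Conn S c a ∧ G.Conn S c b) ∧
          (¬ G.Conn Sᶜ c a ∧ ¬ G.Conn Sᶜ c b ∧ ¬ G.Conn Sᶜ a b)) ∧
          (¬ G.Conn (G.kSwap c S) c a ∧ ¬ G.Conn (G.kSwap c S) c b ∧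
            ¬ G.Conn (G.kSwap c S) a b)) ∧
          ¬ (G.WalkAvoiding S (G.cluster Sᶜ a) c b ∨
            G.WalkAvoiding S (G.cluster Sᶜ b) c a)).card ≤
        (univ.filter fun T : Config E =>
            (G.Conn T c a ∧ ¬ G.Conn T c b) ∨ (G.Conn T c b ∧ ¬ G.Conn T c a)).card +
        2 * (univ.filter fun T : Config E =>
            ((G.Conn T c a ∧ ¬ G.Conn T c b) ∨ (G.Conn T c b ∧ ¬ G.Conn T c a)) ∧
            (G.Conn Tᶜ a b ∧ ¬ G.Conn Tᶜ c a)).card)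
    {z κ x₁ K₁ x₂ K₂ : ℝ}
    (hz : 0 ≤ z ∧ z ≤ 1) (hκ : kMin z ≤ κ) (hx₁ : 0 ≤ x₁ ∧ x₁ ≤ 1) (hx₂ : 0 ≤ x₂ ∧ x₂ ≤ 1)
    (hK₁ : kMin x₁ ≤ K₁) (hK₂ : kMin x₂ ≤ K₂) :
    0 ≤ G.pFun c (threeCells c a b z x₁ x₂) (threeCells c a b κ K₁ K₂) univ :=
  pFun_threeCells_nonneg_of_E00 c a b hz hκ hx₁ hx₂ hK₁ hK₂
    (pFun_liveCells_nonneg_of_residual a b c hR)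

end Count

end MultiGraph

end PercRepro
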